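import Summits.BirchSwinnertonDyer.Rank1Residual.Additive.GordDescentExact
import Summits.BirchSwinnertonDyer.Rank1Residual.X9.PartitionF2
import Literature.NumberTheory.EllipticCurves.Rank1Residual.Typed.X9
import Literature.NumberTheory.EllipticCurves.Rank1Residual.Typed.X10
import HarnessLib

/-!
# X3♯(G-ord) / X4♯(G-ord), defect 2: the COMPLETE relocation statements (every cell of the twist pair)

HONEST FRAMING (cell `b2b-bsdres`, run/shared/lean/b2b/bsd-rank1-residual/, verbatim in every
file): the goal of the cell is to DELETE the COMBINATION-SHAPED residual classes of the
Birch–Swinnerton-Dyer formula for ALL analytic-rank `≤ 1` elliptic curves over `ℚ` — "full BSD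
formula for every rank `≤ 1` curve in class `C`" assembled STRICTLY from published theorems — so
that the rank-`≤ 1` remainder becomes exactly the CONSTRUCTION-SHAPED classes, which are TYPED
(missing-input `Prop`s), NOT attempted. This is not "finishing BSD". Sub-cell `additive-p2`
(X3/X4 at an additive prime, potentially good ORDINARY half): research route; no claim beyond the
stated classes; theorems only, no named fact; X3♯(G-ord)/X4♯(G-ord) stay CONSTRUCTION-SHAPED.

`GordDescent.lean` proved the map "X3♯/X4♯(G-ord) defect-2 pair ↦ cell of the good-ordinary twist
pair `(E^{(p*)}, p)`" row by row. This file assembles the rows into ONE statement per class, with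
NO hypothesis on which cell the twist pair occupies: granted the published facts of the covered
rows, Milne, GZK and modularity,

* `bsdp_of_classX4_of_goodOrd_twist_cases` — **X4** (`p` odd, `E^{(p*)}` good ordinary of analytic
  rank `≤ 1`; no CM hypothesis): `BSD(E,p)` ⇐ `MissingPPartOverAt(E_K,p)` ∧ [if the twist pair is of class
  X9 (`p ≥ 5`, `ρ̄` not surjective): `Typed.X9.MissingInputAt` of the twist] ∧ [if it is of class
  X10 (`p = 3`): `Typed.X10.MissingInputAt` of the twist]. By `covered_or_cases_of_goodOrd_twist`
  these are the only residual cells (X1 needs reducible; CM twists are rows C8/C10; X9im = X9 by the x9 seat's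
  `classX9im_iff_classX9`). Census (N < 2·10⁴, TWIST-CENSUS.md): Covered 369, X9 3, X10 8 of 380.
* `bsdp_of_classX3_of_goodOrd_twist_cases` — **X3** (`p` odd, `E^{(p*)}` good ordinary of analytic
  rank `≤ 1`): `BSD(E,p)` ⇐ `MissingPPartOverAt(E_K,p)` ∧ [if the twist pair is of class X1:
  `Typed.X1.MissingInputAt` of the twist] (`covered_or_classX1_twist_of_classX3`; CM twists are
  rows C8/C10). Census: Covered 57, X1 243 (+1 pair with `r_an(E^{(p*)}) = 2`) of 301.

The located gap is unchanged (module docstring of `GordDescent.lean`): the over-`K` statement is in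
print nowhere; every bracketed input is the typed input of an existing residual class of the cell.
-/

noncomputable section

open scoped Classical

open WeierstrassCurve Literature.NumberTheory.EllipticCurves
  Literature.NumberTheory.EllipticCurves.Rank1Residual
  Literature.NumberTheory.EllipticCurves.Rank1Residual.Typed
  Literature.NumberTheory.EllipticCurves.ModularForms
  Literature.NumberTheory.EllipticCurves.Wuthrich2014
  Summit.BirchSwinnertonDyer.Rank1Residual.AdditivePotMult

namespace Summit.BirchSwinnertonDyer.Rank1Residual.Additive

variable (W : WeierstrassCurve ℚ) [W.IsElliptic] [W.IsGloballyMinimal] (p : ℕ) [hp : Fact p.Prime]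
  (K : Type) [Field K] [NumberField K]
  (Wd : WeierstrassCurve ℚ) [Wd.IsElliptic] [Wd.IsGloballyMinimal]
  (W' : WeierstrassCurve K) [W'.IsElliptic] [W'.IsGloballyMinimal]

/-- **X4♯(G-ord), defect 2 — the complete relocation.** For `(E,p) ∈ X4` (`p` odd, additive,
irreducible; CM allowed — a CM twist pair is row C8/C10) of analytic rank `≤ 1`, `K` the quadratic field of discriminant `p*`,
`Wd` a globally minimal model of `E^{(p*)}` GOOD ORDINARY at `p` of analytic rank `≤ 1`, and `W'` a
globally minimal `K`-model of `E_K`: `BSD(E,p)` follows from the typed over-`K` input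
`MissingPPartOverAt W' p` together with the typed input of the twist pair's OWN residual cell when it
has one — class X9 (`hX9`) or class X10 (`hX10`) — and from nothing else (Covered twist pairs: the
fourteen published facts of the partition's covered rows). No hypothesis singles out the cell: the
case split is `covered_or_cases_of_goodOrd_twist`, X1 being excluded by irreducibility, CM twists
sent to rows C8/C10, and X9im = X9 (`classX9im_iff_classX9`). -/
theorem bsdp_of_classX4_of_goodOrd_twist_cases (hSk : Skinner2016.thmC_padicValRat_bsd_rank_zero)
    (hBCS : BurungaleCastellaSkinner2025.cor131_padicValRat_bsd_rank_le_one)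
    (hJSW : JetchevSkinnerWan2017.thm121_padicValRat_bsd_rank_one)
    (hCGS : CastellaGrossiSkinner2025.thmD_padicValRat_bsd_rank_le_one)
    (hGV : GreenbergVatsal2000.thm13_charIdeal_eq_of_gvPar) (hGr : greenberg_charValue_rankZero)
    (hmod : hasEntireLFunction_rat) (hmodP : nonempty_modularParametrizationData)
    (hGZK : rank_eq_analyticRank_of_analyticRank_le_one)
    (hCM : bsdTriple_of_hasCM_of_L_one_ne_zero) (hKob : Kobayashi2013.cor14_bsdp_of_cm_rank_one)
    (hYZ : YanZhu2026.thm415_padicValRat_bsd_rank_le_one)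
    (hW20 : Wuthrich2014.lemma20_surjective_threeAdic_of_semistable)
    (hLLT : LiLiuTian2024.thm11_bsdp_of_cm_rank_one)
    (hMilne : Milne1972.bsdQuotient_baseChange_quadratic)
    (hX : ClassX4 W p) (hr : W.analyticRank ≤ 1)
    (h2 : Module.finrank ℚ K = 2) (hdK : (NumberField.discr K : ℚ) = (-1 : ℚ) ^ (p / 2) * p)
    (hWd : ∃ C : VariableChange ℚ, C • W.quadraticTwist (NumberField.discr K : ℚ) = Wd)
    (hord : GoodOrd Wd p) (hrd : Wd.analyticRank ≤ 1)
    (hW' : ∃ C : VariableChange K, C • W.baseChange K = W') (hK : MissingPPartOverAt W' p)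
    (hX9 : ClassX9 Wd p → X9.MissingInputAt Wd p) (hX10 : ClassX10 Wd p → X10.MissingInputAt Wd) :
    BSDp W p := by
  have hWd' : ∃ C : VariableChange ℚ, C • W.quadraticTwist ((-1 : ℚ) ^ (p / 2) * p) = Wd := by
    rw [← hdK]; exact hWd
  have hirr : Irr Wd p := (irr_iff_of_model_twist (pStar_ne_zero p) hWd').mpr hX.2.2
  have hd : BSDp Wd p := by
    by_cases hcmd : Wd.HasCM
    · -- a CM twist pair at an odd good prime is row C8 (`r = 0`) or row C10 (`r = 1`)
      refine bsdp_of_covered hSk hBCS hJSW hCGS hGV hGr hmod hmodP hGZK hCM hKob hYZ hW20 hLLT hrd ?_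
      rcases Nat.le_one_iff_eq_zero_or_eq_one.mp hrd with h0 | h1
      · exact Or.inr (Or.inr (Or.inr (Or.inr (Or.inr (Or.inl ⟨hcmd, h0⟩)))))
      · exact Or.inr (Or.inr (Or.inr (Or.inr (Or.inr (Or.inr (Or.inl ⟨hcmd, h1, hX.1, hord.1⟩))))))
    rcases covered_or_cases_of_goodOrd_twist p Wd hX.1 hord hrd with hc | h1 | h9 | h9im | h10 | h12
    · exact bsdp_of_covered hSk hBCS hJSW hCGS hGV hGr hmod hmodP hGZK hCM hKob hYZ hW20 hLLT hrd hc
    · exact absurd hirr h1.2.1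
    · exact X9.bsdp_of_missingInputAt hGZK Wd p hrd h9 (hX9 h9)
    · have h9 : ClassX9 Wd p := (classX9im_iff_classX9 Wd p).mp h9im
      exact X9.bsdp_of_missingInputAt hGZK Wd p hrd h9 (hX9 h9)
    · exact X10.bsdp_of_missingInputAt hYZ hGZK hmod hW20 Wd p hrd h10 (hX10 h10)
    · exact absurd h12.1 hcmd
  exact bsdp_of_pPartOver_of_bsdp_twist' W p K Wd W' hGZK hmod hMilne hr h2 hWd hrd hW' hK hd

/-- **X3♯(G-ord), defect 2 — the complete relocation.** For `(E,p) ∈ X3` (additive Eisenstein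
`p`, odd) of analytic rank `≤ 1`, `K` the quadratic field of discriminant `p*`, `Wd` a globally
minimal model of `E^{(p*)}` GOOD ORDINARY at `p` of analytic rank `≤ 1`, `W'` a globally minimal
`K`-model of `E_K`: `BSD(E,p)` follows from `MissingPPartOverAt W' p` together with the cell's typed
X1 input of the twist pair WHEN that pair is of class X1 (`hX1`), and from nothing else (Covered
twist pairs — CM rows C8/C10, non-anomalous row C6, rank-0 GV row C7 —: the published facts).
Case split `covered_or_classX1_twist_of_classX3`. [cite: Wuthrich2014, Prop. 21 (p. 400)] -/
theorem bsdp_of_classX3_of_goodOrd_twist_cases (hSk : Skinner2016.thmC_padicValRat_bsd_rank_zero)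
    (hBCS : BurungaleCastellaSkinner2025.cor131_padicValRat_bsd_rank_le_one)
    (hJSW : JetchevSkinnerWan2017.thm121_padicValRat_bsd_rank_one)
    (hCGS : CastellaGrossiSkinner2025.thmD_padicValRat_bsd_rank_le_one)
    (hGV : GreenbergVatsal2000.thm13_charIdeal_eq_of_gvPar) (hGr : greenberg_charValue_rankZero)
    (hmod : hasEntireLFunction_rat) (hmodP : nonempty_modularParametrizationData)
    (hGZK : rank_eq_analyticRank_of_analyticRank_le_one)
    (hCM : bsdTriple_of_hasCM_of_L_one_ne_zero) (hKob : Kobayashi2013.cor14_bsdp_of_cm_rank_one)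
    (hYZ : YanZhu2026.thm415_padicValRat_bsd_rank_le_one)
    (hW20 : Wuthrich2014.lemma20_surjective_threeAdic_of_semistable)
    (hLLT : LiLiuTian2024.thm11_bsdp_of_cm_rank_one)
    (hMilne : Milne1972.bsdQuotient_baseChange_quadratic) (hW : sha_dvd_analyticSha)
    (hX : ClassX3 W p) (hp2 : p ≠ 2) (hr : W.analyticRank ≤ 1)
    (h2 : Module.finrank ℚ K = 2) (hdK : (NumberField.discr K : ℚ) = (-1 : ℚ) ^ (p / 2) * p)
    (hWd : ∃ C : VariableChange ℚ, C • W.quadraticTwist (NumberField.discr K : ℚ) = Wd)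
    (hord : GoodOrd Wd p) (hrd : Wd.analyticRank ≤ 1)
    (hW' : ∃ C : VariableChange K, C • W.baseChange K = W') (hK : MissingPPartOverAt W' p)
    (hX1 : ClassX1 Wd p → X1.MissingInputAt Wd p) : BSDp W p := by
  have hWd' : ∃ C : VariableChange ℚ, C • W.quadraticTwist ((-1 : ℚ) ^ (p / 2) * p) = Wd := by
    rw [← hdK]; exact hWd
  have hd : BSDp Wd p := by
    rcases covered_or_classX1_twist_of_classX3 W p Wd hp2 hX hWd' hord hrd with hc | h1
    · exact bsdp_of_covered hSk hBCS hJSW hCGS hGV hGr hmod hmodP hGZK hCM hKob hYZ hW20 hLLT hrd hc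
    · exact X1.bsdp_of_missingInputAt hW hGZK hmod Wd p hrd h1 (hX1 h1)
  exact bsdp_of_pPartOver_of_bsdp_twist' W p K Wd W' hGZK hmod hMilne hr h2 hWd hrd hW' hK hd

end Summit.BirchSwinnertonDyer.Rank1Residual.Additive

end
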